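import Mathlib.Geometry.Manifold.HasGroupoid
import Mathlib.Topology.Homotopy.Contractible
import Mathlib.Analysis.Normed.Module.Convex
import Mathlib.Analysis.Normed.Module.FiniteDimension
import HarnessLib

/-!
# Pinching finitely many points of a manifold, I: chart discs, radial contractions, disc systems

Topological toolkit for the image `K = q(N)` of a (compact) space `N` charted on a real normed
space `E` under a quotient map `q : N → K` which is injective except on a finite set `F` — `K` is
`N` with finitely many finite sets of points pinched together; the motivating instance is the set
of complex points of an irreducible complex curve as the image of its normalisation (Deligne,
*Théorie de Hodge III*, Prop. 8.2.7 / Cor. 8.2.8 in the curve case, where no mixed Hodge theory is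
needed). This file:

* `chartDisc n s`, `chartCDisc n s` — the open / closed disc of radius `s` around `n` in the chart
  at `n`, for a `GoodRadius` (closed chart ball inside the chart target): open, resp. compact; they
  form a basis of neighbourhoods of `n` (`exists_goodRadius_chartDisc_subset`);
* `radialPoint`, `radialHomotopy` — the straight-line contraction in the chart contracts a chart
  disc onto its centre keeping the centre fixed (`contractibleSpace_chartDisc`);
* `DiscSystem F` — pairwise disjoint chart discs of good radius around the points of a finite set
  `F` (they exist inside any prescribed neighbourhoods, `exists_discSystem`), the unions
  `discsOver q D y` of the discs of the points of `F` over `y`, and their SATURATION under a map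
  injective off `F` (`preimage_image_discsOver`), whence the pinched wedges `q(discsOver)` are open.

Sequel: `PinchWedges` (the pinched wedges are contractible; the pinched space is locally
contractible), `PinchCohomology` (`q* : H²(K) → H²(N)` is injective). Everything is proved;
standard point-set topology (Hatcher, *Algebraic Topology*, Ch. 0 and App. A for the notions).

## References

* [HatcherAT2002] A. Hatcher, Algebraic Topology, CUP 2002, Ch. 0 (homotopies, contractibility),
  App. A (local contractibility).
* [DeligneHodgeIII1974] P. Deligne, Théorie de Hodge III, Publ. Math. IHÉS 44 (1974), Prop. 8.2.7.
-/

noncomputable section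

open Set Filter Topology unitInterval

namespace Literature.AlgebraicTopology.SingularHomology

namespace Pinch

section Discs

variable {E : Type*} [NormedAddCommGroup E] {N : Type*} [TopologicalSpace N] [ChartedSpace E N]

/-! ### Chart discs -/

variable (E) in
/-- The open disc of radius `s` around `n` in the chart at `n`. [folklore] -/
def chartDisc (n : N) (s : ℝ) : Set N :=
  (chartAt E n).source ∩ chartAt E n ⁻¹' Metric.ball (chartAt E n n) s

variable (E) in
/-- The closed disc of radius `s` around `n` in the chart at `n`. [folklore] -/
def chartCDisc (n : N) (s : ℝ) : Set N :=
  (chartAt E n).source ∩ chartAt E n ⁻¹' Metric.closedBall (chartAt E n n) s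

variable (E) in
/-- A radius is **good** at `n` if it is positive and the closed chart ball of that radius lies in
the target of the chart at `n`. [folklore] -/
def GoodRadius (n : N) (s : ℝ) : Prop :=
  0 < s ∧ Metric.closedBall (chartAt E n n) s ⊆ (chartAt E n).target

/-- Good radii exist. [folklore] -/
theorem exists_goodRadius (n : N) : ∃ s, GoodRadius E n s := by
  obtain ⟨ε, hε, hball⟩ := Metric.isOpen_iff.1 (chartAt E n).open_target (chartAt E n n)
    (mem_chart_target E n)
  exact ⟨ε / 2, half_pos hε, (Metric.closedBall_subset_ball (half_lt_self hε)).trans hball⟩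

/-- Smaller positive radii are good. [folklore] -/
theorem GoodRadius.mono {n : N} {s s' : ℝ} (h : GoodRadius E n s) (hs' : 0 < s') (hle : s' ≤ s) :
    GoodRadius E n s' :=
  ⟨hs', (Metric.closedBall_subset_closedBall hle).trans h.2⟩

/-- A good radius is positive. [folklore] -/
theorem GoodRadius.pos {n : N} {s : ℝ} (h : GoodRadius E n s) : 0 < s := h.1

/-- The open chart ball of a good radius lies in the chart target. [folklore] -/
theorem GoodRadius.ball_subset_target {n : N} {s : ℝ} (h : GoodRadius E n s) :
    Metric.ball (chartAt E n n) s ⊆ (chartAt E n).target :=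
  Metric.ball_subset_closedBall.trans h.2

/-- Chart discs are open. [folklore] -/
theorem isOpen_chartDisc (n : N) (s : ℝ) : IsOpen (chartDisc E n s) :=
  (chartAt E n).isOpen_inter_preimage Metric.isOpen_ball

/-- The centre lies in its chart discs. [folklore] -/
theorem mem_chartDisc_self (n : N) {s : ℝ} (hs : 0 < s) : n ∈ chartDisc E n s :=
  ⟨mem_chart_source E n, Metric.mem_ball_self hs⟩

/-- Chart discs lie in the chart source. [folklore] -/
theorem chartDisc_subset_source (n : N) (s : ℝ) : chartDisc E n s ⊆ (chartAt E n).source :=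
  inter_subset_left

/-- The open chart disc lies in the closed one. [folklore] -/
theorem chartDisc_subset_chartCDisc (n : N) (s : ℝ) : chartDisc E n s ⊆ chartCDisc E n s :=
  inter_subset_inter_right _ (preimage_mono Metric.ball_subset_closedBall)

/-- A closed chart disc lies in any larger open chart disc. [folklore] -/
theorem chartCDisc_subset_chartDisc (n : N) {s s' : ℝ} (h : s < s') : chartCDisc E n s ⊆ chartDisc E n s' :=
  inter_subset_inter_right _ (preimage_mono (Metric.closedBall_subset_ball h))

/-- Chart discs grow with the radius. [folklore] -/
theorem chartDisc_mono (n : N) {s s' : ℝ} (h : s ≤ s') : chartDisc E n s ⊆ chartDisc E n s' :=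
  inter_subset_inter_right _ (preimage_mono (Metric.ball_subset_ball h))

/-- The centre lies in its closed chart discs. [folklore] -/
theorem mem_chartCDisc_self (n : N) {s : ℝ} (hs : 0 ≤ s) : n ∈ chartCDisc E n s :=
  ⟨mem_chart_source E n, Metric.mem_closedBall_self hs⟩

/-- The chart disc is a neighbourhood of its centre. [folklore] -/
theorem chartDisc_mem_nhds (n : N) {s : ℝ} (hs : 0 < s) : chartDisc E n s ∈ 𝓝 n :=
  (isOpen_chartDisc n s).mem_nhds (mem_chartDisc_self n hs)

/-- A closed chart disc of good radius is the image of the closed chart ball. [folklore] -/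
theorem chartCDisc_eq_image {n : N} {s : ℝ} (h : GoodRadius E n s) :
    chartCDisc E n s = (chartAt E n).symm '' Metric.closedBall (chartAt E n n) s := by
  rw [chartCDisc, (chartAt E n).symm_image_eq_source_inter_preimage h.2]

/-- A chart disc of good radius is the image of the chart ball. [folklore] -/
theorem chartDisc_eq_image {n : N} {s : ℝ} (h : GoodRadius E n s) :
    chartDisc E n s = (chartAt E n).symm '' Metric.ball (chartAt E n n) s := by
  rw [chartDisc, (chartAt E n).symm_image_eq_source_inter_preimage h.ball_subset_target]

/-- Closed chart discs of good radius are compact (the model being proper). [folklore] -/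
theorem isCompact_chartCDisc [ProperSpace E] {n : N} {s : ℝ} (h : GoodRadius E n s) :
    IsCompact (chartCDisc E n s) := by
  rw [chartCDisc_eq_image h]
  exact (isCompact_closedBall _ _).image_of_continuousOn ((chartAt E n).continuousOn_symm.mono h.2)

/-- Closed chart discs of good radius are closed (`N` Hausdorff). [folklore] -/
theorem isClosed_chartCDisc [ProperSpace E] [T2Space N] {n : N} {s : ℝ} (h : GoodRadius E n s) :
    IsClosed (chartCDisc E n s) :=
  (isCompact_chartCDisc h).isClosed

/-- **Chart discs form a basis of neighbourhoods**: every neighbourhood of `n` contains a chart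
disc of good radius. [folklore] -/
theorem exists_goodRadius_chartDisc_subset {n : N} {U : Set N} (hU : U ∈ 𝓝 n) :
    ∃ s, GoodRadius E n s ∧ chartDisc E n s ⊆ U := by
  obtain ⟨s₀, hs₀⟩ := exists_goodRadius (E := E) n
  -- push `U ∩ source` into the chart: an open set around `chartAt n n`
  have hT : (chartAt E n) '' ((chartAt E n).source ∩ interior U) ∈ 𝓝 (chartAt E n n) := by
    refine ((chartAt E n).isOpen_image_of_subset_source ((chartAt E n).open_source.inter
      isOpen_interior) inter_subset_left).mem_nhds ⟨n, ⟨mem_chart_source E n, ?_⟩, rfl⟩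
    exact mem_interior_iff_mem_nhds.2 hU
  obtain ⟨ε, hε, hball⟩ := Metric.mem_nhds_iff.1 hT
  refine ⟨min ε s₀, hs₀.mono (lt_min hε hs₀.pos) (min_le_right _ _), fun x hx ↦ ?_⟩
  have hx' : chartAt E n x ∈ Metric.ball (chartAt E n n) ε :=
    Metric.ball_subset_ball (min_le_left _ _) hx.2
  obtain ⟨y, hy, hyx⟩ := hball hx'
  have : y = x := by
    rw [← (chartAt E n).left_inv hy.1, hyx, (chartAt E n).left_inv hx.1]
  rw [← this]
  exact interior_subset hy.2

end Discs

section Radial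

variable {E : Type*} [NormedAddCommGroup E] [NormedSpace ℝ E]
  {N : Type*} [TopologicalSpace N] [ChartedSpace E N]

/-! ### The radial contraction of a chart disc -/

/-- The straight-line combination in the chart stays in the chart ball. [folklore] -/
theorem lineMap_mem_ball {n : N} {s : ℝ} {x : N} (hx : x ∈ chartDisc E n s) (t : I) :
    chartAt E n n + ((1 : ℝ) - t) • (chartAt E n x - chartAt E n n) ∈ Metric.ball (chartAt E n n) s := by
  rw [Metric.mem_ball, dist_eq_norm, add_sub_cancel_left, norm_smul, Real.norm_eq_abs,
    abs_of_nonneg (sub_nonneg.2 t.2.2)]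
  have h1 : ‖chartAt E n x - chartAt E n n‖ < s := by rw [← dist_eq_norm]; exact hx.2
  have h2 : (1 : ℝ) - t ≤ 1 := sub_le_self _ t.2.1
  calc ((1 : ℝ) - t) * ‖chartAt E n x - chartAt E n n‖ ≤ 1 * ‖chartAt E n x - chartAt E n n‖ :=
        mul_le_mul_of_nonneg_right h2 (norm_nonneg _)
    _ < s := by rw [one_mul]; exact h1

/-- The point of the radial contraction at time `t`. [folklore] -/
def radialPoint (n : N) (t : I) (x : N) : N :=
  (chartAt E n).symm (chartAt E n n + ((1 : ℝ) - t) • (chartAt E n x - chartAt E n n))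

/-- The radial contraction stays in the chart disc (good radius). [folklore] -/
theorem radialPoint_mem_chartDisc {n : N} {s : ℝ} (h : GoodRadius E n s) {x : N}
    (hx : x ∈ chartDisc E n s) (t : I) : radialPoint (E := E) n t x ∈ chartDisc E n s := by
  have hb := lineMap_mem_ball hx t
  refine ⟨(chartAt E n).map_target (h.ball_subset_target hb), ?_⟩
  rw [mem_preimage, radialPoint, (chartAt E n).right_inv (h.ball_subset_target hb)]
  exact hb

/-- At time `0` the radial contraction is the identity on the chart disc. [folklore] -/
theorem radialPoint_zero {n : N} {s : ℝ} {x : N} (hx : x ∈ chartDisc E n s) :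
    radialPoint (E := E) n 0 x = x := by
  simp only [radialPoint, Icc.coe_zero, sub_zero, one_smul, add_sub_cancel]
  exact (chartAt E n).left_inv hx.1

/-- At time `1` the radial contraction is the centre. [folklore] -/
theorem radialPoint_one (n : N) (x : N) : radialPoint (E := E) n 1 x = n := by
  simp only [radialPoint, Icc.coe_one, sub_self, zero_smul, add_zero]
  exact (chartAt E n).left_inv (mem_chart_source E n)

/-- The centre is fixed by the radial contraction. [folklore] -/
theorem radialPoint_self (n : N) (t : I) : radialPoint (E := E) n t n = n := by
  simp only [radialPoint, sub_self, smul_zero, add_zero]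
  exact (chartAt E n).left_inv (mem_chart_source E n)

/-- The radial contraction is continuous on `I × chartDisc`. [folklore] -/
theorem continuousOn_radialPoint {n : N} {s : ℝ} (h : GoodRadius E n s) :
    ContinuousOn (fun p : I × N ↦ radialPoint (E := E) n p.1 p.2) (univ ×ˢ chartDisc E n s) := by
  have hφ : ContinuousOn (fun p : I × N ↦ chartAt E n p.2) (univ ×ˢ chartDisc E n s) :=
    (chartAt E n).continuousOn.comp continuous_snd.continuousOn
      (fun p hp ↦ (chartDisc_subset_source n s) hp.2)
  have hlin : ContinuousOn
      (fun p : I × N ↦ chartAt E n n + ((1 : ℝ) - p.1) • (chartAt E n p.2 - chartAt E n n))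
      (univ ×ˢ chartDisc E n s) := by
    refine continuousOn_const.add (ContinuousOn.smul ?_ (hφ.sub continuousOn_const))
    exact (continuous_const.sub (continuous_induced_dom.comp continuous_fst)).continuousOn
  refine (chartAt E n).continuousOn_symm.comp hlin fun p hp ↦ h.ball_subset_target ?_
  exact lineMap_mem_ball hp.2 p.1

/-- **The radial contraction of a chart disc of good radius onto its centre**, as a homotopy from
the identity of `↥(chartDisc n s)` to the constant map at `n`. [folklore] -/
def radialHomotopy {n : N} {s : ℝ} (h : GoodRadius E n s) :
    ContinuousMap.Homotopy (ContinuousMap.id ↥(chartDisc E n s))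
      (ContinuousMap.const ↥(chartDisc E n s) ⟨n, mem_chartDisc_self n h.pos⟩) where
  toFun p := ⟨radialPoint (E := E) n p.1 p.2.1, radialPoint_mem_chartDisc h p.2.2 p.1⟩
  continuous_toFun := by
    refine Continuous.subtype_mk ?_ _
    have hc := continuousOn_radialPoint (E := E) h
    exact hc.comp_continuous (continuous_fst.prodMk (continuous_subtype_val.comp continuous_snd))
      fun p ↦ ⟨mem_univ _, p.2.2⟩
  map_zero_left x := Subtype.ext (radialPoint_zero x.2)
  map_one_left x := Subtype.ext (radialPoint_one n x.1)

/-- Chart discs of good radius are contractible. [folklore] -/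
theorem contractibleSpace_chartDisc {n : N} {s : ℝ} (h : GoodRadius E n s) :
    ContractibleSpace ↥(chartDisc E n s) :=
  (contractible_iff_id_nullhomotopic _).2 ⟨⟨n, mem_chartDisc_self n h.pos⟩, ⟨radialHomotopy h⟩⟩

end Radial

/-! ### Disc systems around a finite set, and the pinched wedges -/

section Wedge

variable {E : Type*} [NormedAddCommGroup E]
  {N : Type*} [TopologicalSpace N] [ChartedSpace E N] {K : Type*}

variable (E) in
/-- A **disc system** for the finite set `F ⊆ N`: a good radius at each point of `F` such that the
chart discs of the points of `F` are pairwise disjoint. [folklore] -/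
structure DiscSystem (F : Set N) where
  /-- the radius at each point [folklore] -/
  rad : N → ℝ
  /-- the radii are good at the points of `F` [folklore] -/
  good : ∀ ⦃n⦄, n ∈ F → GoodRadius E n (rad n)
  /-- the discs of distinct points of `F` are disjoint [folklore] -/
  disjoint : ∀ ⦃n⦄, n ∈ F → ∀ ⦃n'⦄, n' ∈ F → n ≠ n' →
    Disjoint (chartDisc E n (rad n)) (chartDisc E n' (rad n'))

namespace DiscSystem

variable {F : Set N} (D : DiscSystem E F)

/-- The disc of `n` in the disc system. [folklore] -/
abbrev disc (n : N) : Set N := chartDisc E n (D.rad n)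

/-- A point of `F` lies in its disc. [folklore] -/
theorem mem_disc_self {n : N} (hn : n ∈ F) : n ∈ D.disc n := mem_chartDisc_self n (D.good hn).pos

/-- A point of `F` in the disc of a point of `F` is its centre. [folklore] -/
theorem eq_of_mem_disc {n n' : N} (hn : n ∈ F) (hn' : n' ∈ F) (h : n' ∈ D.disc n) : n' = n := by
  by_contra hne
  exact Set.disjoint_left.1 (D.disjoint hn hn' (Ne.symm hne)) h (D.mem_disc_self hn')

/-- Two discs of points of `F` sharing a point have the same centre. [folklore] -/
theorem eq_of_mem_disc_of_mem_disc {n n' x : N} (hn : n ∈ F) (hn' : n' ∈ F) (h : x ∈ D.disc n)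
    (h' : x ∈ D.disc n') : n = n' := by
  by_contra hne
  exact Set.disjoint_left.1 (D.disjoint hn hn' hne) h h'

/-- Shrinking the radii (keeping them positive) gives a disc system. [folklore] -/
def shrink (r : N → ℝ) (hr : ∀ ⦃n⦄, n ∈ F → 0 < r n ∧ r n ≤ D.rad n) : DiscSystem E F where
  rad := r
  good _ hn := (D.good hn).mono (hr hn).1 (hr hn).2
  disjoint n hn n' hn' hne := (D.disjoint hn hn' hne).mono (chartDisc_mono n (hr hn).2)
    (chartDisc_mono n' (hr hn').2)

/-- The radii of a shrunk disc system. [folklore] -/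
@[simp] theorem shrink_rad (r : N → ℝ) (hr : ∀ ⦃n⦄, n ∈ F → 0 < r n ∧ r n ≤ D.rad n) :
    (D.shrink r hr).rad = r := rfl

end DiscSystem

/-- **Disc systems exist inside prescribed neighbourhoods**: for `F` finite in a Hausdorff `N` and
neighbourhoods `U n` of the `n ∈ F`, there is a disc system whose discs satisfy `disc n ⊆ U n` for
`n ∈ F` (separate the points of `F` by disjoint open sets, then take small chart discs).
[folklore] -/
theorem exists_discSystem [T2Space N] {F : Set N} (hF : F.Finite) (U : N → Set N)
    (hU : ∀ ⦃n⦄, n ∈ F → U n ∈ 𝓝 n) :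
    ∃ D : DiscSystem E F, ∀ ⦃n⦄, n ∈ F → D.disc n ⊆ U n := by
  classical
  obtain ⟨O, hO, hdisj⟩ := hF.t2_separation
  have h : ∀ n, ∃ s, n ∈ F → GoodRadius E n s ∧ chartDisc E n s ⊆ U n ∩ O n := by
    intro n
    by_cases hn : n ∈ F
    · obtain ⟨s, hs, hsub⟩ := exists_goodRadius_chartDisc_subset (E := E)
        (Filter.inter_mem (hU hn) ((hO n).2.mem_nhds (hO n).1))
      exact ⟨s, fun _ ↦ ⟨hs, hsub⟩⟩
    · exact ⟨1, fun h ↦ (hn h).elim⟩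
  choose r hr using h
  refine ⟨⟨r, fun n hn ↦ (hr n hn).1, fun n hn n' hn' hne ↦ ?_⟩, fun n hn ↦
    ((hr n hn).2.trans inter_subset_left)⟩
  exact (hdisj hn hn' hne).mono ((hr n hn).2.trans inter_subset_right)
    ((hr n' hn').2.trans inter_subset_right)

/-! ### The pinch hypotheses -/

/-- The union of the discs of the points of `F` over `y₀`. [folklore] -/
def discsOver (q : N → K) {F : Set N} (D : DiscSystem E F) (y₀ : K) : Set N :=
  ⋃ (n : N) (_ : n ∈ F) (_ : q n = y₀), D.disc n

/-- The union of the discs over `y₀` is open. [folklore] -/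
theorem isOpen_discsOver (q : N → K) {F : Set N} (D : DiscSystem E F) (y₀ : K) :
    IsOpen (discsOver q D y₀) :=
  isOpen_iUnion fun n ↦ isOpen_iUnion fun _ ↦ isOpen_iUnion fun _ ↦ isOpen_chartDisc n _

/-- Membership in the discs over `y₀`. [folklore] -/
theorem mem_discsOver_iff {q : N → K} {F : Set N} {D : DiscSystem E F} {y₀ : K} {x : N} :
    x ∈ discsOver q D y₀ ↔ ∃ n ∈ F, q n = y₀ ∧ x ∈ D.disc n := by
  simp only [discsOver, mem_iUnion, exists_prop]

/-- The disc of a point of `F` lies in the discs over its image. [folklore] -/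
theorem disc_subset_discsOver (q : N → K) {F : Set N} (D : DiscSystem E F) {n : N} (hn : n ∈ F) :
    D.disc n ⊆ discsOver q D (q n) := fun _ hx ↦ mem_discsOver_iff.2 ⟨n, hn, rfl, hx⟩

variable {q : N → K} {F : Set N}

/-- **Saturation of the discs over `y₀`** when `q` is injective off `F`:
`q⁻¹(q(discsOver y₀)) = discsOver y₀`. [folklore] -/
theorem preimage_image_discsOver (hinj : ∀ ⦃a b : N⦄, q a = q b → a ≠ b → a ∈ F ∧ b ∈ F)
    (D : DiscSystem E F) (y₀ : K) : q ⁻¹' (q '' discsOver q D y₀) = discsOver q D y₀ := by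
  refine Subset.antisymm (fun x hx ↦ ?_) (subset_preimage_image q _)
  obtain ⟨y, hy, hxy⟩ := hx
  obtain ⟨n, hn, hqn, hyn⟩ := mem_discsOver_iff.1 hy
  by_cases hxy' : y = x
  · exact hxy' ▸ hy
  · obtain ⟨hyF, hxF⟩ := hinj hxy hxy'
    have hy' : y = n := D.eq_of_mem_disc hn hyF hyn
    refine mem_discsOver_iff.2 ⟨x, hxF, ?_, D.mem_disc_self hxF⟩
    rw [← hxy, hy', hqn]

/-- The pinched wedge `q(discsOver y₀)` is open (`q` a quotient map). [folklore] -/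
theorem isOpen_image_discsOver [TopologicalSpace K] (hq : IsQuotientMap q)
    (hinj : ∀ ⦃a b : N⦄, q a = q b → a ≠ b → a ∈ F ∧ b ∈ F) (D : DiscSystem E F) (y₀ : K) :
    IsOpen (q '' discsOver q D y₀) := by
  rw [← hq.isOpen_preimage, preimage_image_discsOver hinj D y₀]
  exact isOpen_discsOver q D y₀

/-- A point of `F` in the discs over `y₀` is a centre over `y₀`. [folklore] -/
theorem apply_eq_of_mem_discsOver {D : DiscSystem E F} {y₀ : K} {x : N} (hxF : x ∈ F)
    (hx : x ∈ discsOver q D y₀) : q x = y₀ := by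
  obtain ⟨n, hn, hqn, hxn⟩ := mem_discsOver_iff.1 hx
  rw [D.eq_of_mem_disc hn hxF hxn, hqn]

end Wedge

end Pinch

end Literature.AlgebraicTopology.SingularHomology

end
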